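import Literature.MathematicalPhysics.QuantumFieldTheory.Balaban1983to89.B9Thm31SiteLapGpDecayReg335Y
import Literature.MathematicalPhysics.QuantumFieldTheory.Balaban1983to89.B9Thm31SiteGpDivDecayReg335Y

/-!
# `Balaban1983to89.B9Thm31SiteGpLapDecayReg335Y` — T. Bałaban, *Propagators for lattice gauge theories in a background field*, Commun. Math. Phys. **99**
# (1985) 389–434 [Balaban1985BackgroundPropagators] Thm 3.1 (3.46) p. 398 (the `G′(U)Δ_U` entry) with (3.8)∕(3.23) pp. 392–394: ★★★ **THE `L²`-LOCAL DECAY OF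
# `G′(U)Δ_U`, BY DUALITY FROM (3.46d)** — `Σ_{z∈B} HS((G′(U)Δ_Uλ)(z)) ≤ 256·(L^{j₁})⁻⁴(L^{j_Ā})²(L^{j_B})²·W⁻²·‖λ‖²₁` for `λ` supported in a source-free set `A`
# (file 16 of the site-coercivity set of width seat `pub-ymgap-dag-n06-w1`; the transpose of file 13 through the symmetry of `Δ_U` and `G′`)

statement-level skeleton of published theorems with citation tags; proofs where landed; nothing here is a claim about the Yang–Mills mass gap

THE PRINT (p. 398).  (3.46) bounds the `L²` norms of `G′`, `∇_UG′`, `G′∇\*_U`, `Δ_UG′`, … between localised sources and readings by `B₀·(scale factors)·e^{−δ₀d(y,y′)}`;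
(3.23) p. 394: `Δ_U = D\*_UD_U` is symmetric for the trace pairing.  The `G′Δ_U` entry is the TRANSPOSE of the `Δ_UG′` entry.

WHY THIS FILE ∕ THE ARGUMENT.  File 13 (`B9Thm31SiteLapGpDecayReg335Y.hs_restrict_lapSL_GpY_le`) bounds `Σ_{z∈A}HS((Δ_UG′(U)Ψ)(z))` for `Ψ` supported in `B` and
vanishing on `A`; file 9's generic duality (`hs_restrict_dual_le`) transposes any such support-restricted bound through a trace-adjoint pair; `Δ_U∘G′` and `G′∘Δ_U`
are adjoint at a unitary background (dag-n06-j's `lapSL_isSymmTr`, dag-n06-i's `isSymmTr_GpY_parSymY`).  With `A ∩ B = ∅` the vanishing of `Ψ` on `A` is automatic.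

WHAT IS PROVED (sorry-free; 0 `def`; nothing of [B9] asserted beyond what is proved).
* `trIP_lapSL_GpY_adjoint` (`⟨Δ_UG′Ψ, λ⟩₁ = ⟨Ψ, G′Δ_Uλ⟩₁`), ★★★ **`hs_restrict_GpY_lapSL_le`** (abstract weight; hypotheses of file 13 with `Disjoint A B`:
  `Σ_{z∈B}HS((G′(U)Δ_Uλ)(z)) ≤ 256·((L^{j₁})⁻⁴(L^{j_Ā})²(L^{j_B})²∕W²)·‖λ‖²₁` for every `λ` vanishing off `A`), ★★★ **`hs_restrict_GpY_lapSL_le_exp_canonical`**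
  (`e^{δ₀ρ}`, `δ₀ = 1∕(4(d+2))`).
MODEL ∕ DECLARED READINGS.  As files 6–13; here `λ` lives on the source-free set `A` (levels `≥ j₁`, blocks inside `Ā` where `ω ≥ W`) and `G′Δ_Uλ` is read on
`B` (where `ω = 1`, levels `≤ j_B`).  NOT HERE: (3.42)–(3.45), the sup-norm (3.47), the bond sector.  HONEST SCOPE.  A duality bookkeeping step for one finite
lattice operator; NOT a node discharge, NOT summit progress; count-neutral; nothing continuum ∕ OS ∕ mass gap ∕ Clay.  NEW file importing files 9 and 13 only.
-/

noncomputable section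

namespace Literature.MathematicalPhysics.QuantumFieldTheory.Balaban1983to89.B9Thm31SiteGpLapDecayReg335Y

open Literature.MathematicalPhysics.QuantumFieldTheory.Balaban1983to89
open Node00 B6KLevelCensusIndexV1 B6Geom246MultiLevelBox B6MultiLevelBoxOperator B6MultiLevelTorusOperator B6GlobalChartV1 B9BackgroundsKLevelV1
  B9Eq39Adjoint B9Thm311ReadingCoords B9Thm311DeltaPrimePos B9Ineq369CurvatureSmallAtLettersY B9Thm31SiteCoerciveGaugeBlockY
  B9Thm31SiteCoerciveReg335Y B9Thm31SiteGpBoundsReg335Y B9Thm31SitePolarisedFormY B9Thm31SiteConjugatedFormY B9Thm31SiteGpDecayReg335Y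
  B9Thm31SiteAgmonWeightY B9Thm31SiteLapGpDecayReg335Y B9Thm31SiteGpDivDecayReg335Y
open Literature.MathematicalPhysics.QuantumFieldTheory.Balaban1983to89.B9Ineq349SiteAdjoint (trIP_comm isSymmTr_GpY_parSymY)
open Literature.MathematicalPhysics.QuantumFieldTheory.Balaban1983to89.B9Thm311DeltaPrimeSymm (lapSL_isSymmTr)
open scoped Matrix Matrix.Norms.L2Operator

variable {d ℓ : ℕ} {hd : 1 ≤ d + 1} {hL : Odd (ℓ + 1) ∧ 1 < ℓ + 1} {b₀ b₁ : ℝ}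
variable (i : KIdx d ℓ hd hL b₀ b₁) {N : ℕ} {G : Subgroup (Matrix (Fin N) (Fin N) ℂ)ˣ}

/-- `Δ_U∘G′(U)` AND `G′(U)∘Δ_U` ARE ADJOINT for the trace pairing at a `G`-valued background, `G ≤ U(N)`: `⟨Δ_UG′Ψ, λ⟩₁ = ⟨Ψ, G′Δ_Uλ⟩₁`.
[cite: Balaban1985BackgroundPropagators, (3.23) p.394, (3.25) p.394] -/
theorem trIP_lapSL_GpY_adjoint (hG : G ≤ B7Prop2Explicit.unitaryUnits (Matrix (Fin N) (Fin N) ℂ)) {U : CfgY (Matrix (Fin N) (Fin N) ℂ) i}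
    (hU : ∀ μ x, U μ x ∈ G) (Ψ Λ : SiteY i → Matrix (Fin N) (Fin N) ℂ) :
    trIP (fun _ => (1 : ℝ)) (lapSL i U (GpY i (parSymY i) U Ψ)) Λ = trIP (fun _ => (1 : ℝ)) Ψ (GpY i (parSymY i) U (lapSL i U Λ)) := by
  rw [lapSL_isSymmTr i U (fun μ x => hG (hU μ x)), isSymmTr_GpY_parSymY i hG hU]

/-- ★★★ **THE `L²`-LOCAL DECAY OF `G′(U)Δ_U` ON THE CLASS (3.35) — BY DUALITY FROM FILE 13.**  Class hypotheses and an admissible weight `ω` (`ω = 1` on `B`, `ω ≥ W > 0`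
on `Ā`, bond ratios, block oscillation, `(d+1)θ_b + θ_s∕2 ≤ 1∕16`, levels `≤ j_Ā` on `Ā`, `≤ j_B` on `B`); a set `A` DISJOINT from `B` with levels `≥ j₁` and `Ā ⊇`
every block meeting `A`.  THEN for every `λ` vanishing off `A`: `Σ_{z∈B} HS((G′(U)Δ_Uλ)(z)) ≤ 256·((L^{j₁})⁻⁴(L^{j_Ā})²(L^{j_B})²∕W²)·‖λ‖²₁`.
[cite: Balaban1985BackgroundPropagators, Thm 3.1 (3.46) p.398, (3.23) p.394, (3.35) p.396; Agmon1982, Ch.1, Thm 1.5] -/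
theorem hs_restrict_GpY_lapSL_le [Nonempty (Fin N)] (hG : G ≤ B7Prop2Explicit.unitaryUnits (Matrix (Fin N) (Fin N) ℂ))
    {U : CfgY (Matrix (Fin N) (Fin N) ℂ) i} {c α₀ : ℝ} (hC0 : 0 ≤ c * (kGeo i).M * α₀) (hC1 : c * (kGeo i).M * α₀ * ((d : ℝ) + 1) ≤ 1 / 16)
    (hreg : (bg9K (Matrix (Fin N) (Fin N) ℂ) G i).Reg335 c α₀ U) {ω : SiteY i → ℝ} (hω : ∀ z, 0 < ω z) {θb θs : ℝ}
    (hb1 : ∀ μ z, ω (shiftY i μ z) / ω z + ω z / ω (shiftY i μ z) - 2 ≤ θb * (((((ℓ + 1) ^ (blkOf i.D.toDomains z).1.1 : ℕ) : ℝ)) ^ 2)⁻¹)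
    (hb2 : ∀ μ z, ω (shiftY i μ z) / ω z + ω z / ω (shiftY i μ z) - 2 ≤ θb * (((((ℓ + 1) ^ (blkOf i.D.toDomains (shiftY i μ z)).1.1 : ℕ) : ℝ)) ^ 2)⁻¹)
    (hs : ∀ z w : SiteY i, blkOf i.D.toDomains w = blkOf i.D.toDomains z → ω z / ω w + ω w / ω z - 2 ≤ θs)
    (hκ : ((d : ℝ) + 1) * θb + θs / 2 ≤ 1 / 16)
    {A Abar B : Finset (SiteY i)} (hAB : Disjoint A B) (hωB : ∀ z ∈ B, ω z = 1)
    (hĀ : ∀ z ∈ A, ∀ w, blkOf i.D.toDomains w = blkOf i.D.toDomains z → w ∈ Abar) {j₁ jA jB : ℕ} (hj₁ : ∀ z ∈ A, j₁ ≤ (blkOf i.D.toDomains z).1.1)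
    (hjA : ∀ z ∈ Abar, (blkOf i.D.toDomains z).1.1 ≤ jA) (hjB : ∀ z ∈ B, (blkOf i.D.toDomains z).1.1 ≤ jB) {W : ℝ} (hW0 : 0 < W) (hW : ∀ z ∈ Abar, W ≤ ω z)
    (Λ : SiteY i → Matrix (Fin N) (Fin N) ℂ) (hΛ : ∀ z, z ∉ A → Λ z = 0) :
    ∑ z ∈ B, ∑ a, ∑ b, ‖GpY i (parSymY i) U (lapSL i U Λ) z a b‖ ^ 2
      ≤ 256 * (((((((ℓ + 1) ^ j₁ : ℕ) : ℝ)) ^ 2)⁻¹) ^ 2 *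
          (((((ℓ + 1) ^ jA : ℕ) : ℝ)) ^ 2 * ((((ℓ + 1) ^ jB : ℕ) : ℝ)) ^ 2 / W ^ 2)) * trIP (fun _ => (1 : ℝ)) Λ Λ := by
  classical
  have hU : ∀ μ x, U μ x ∈ G := hreg.1
  refine hs_restrict_dual_le (T := fun Ψ => lapSL i U (GpY i (parSymY i) U Ψ)) (T' := fun Λ => GpY i (parSymY i) U (lapSL i U Λ))
    (fun Ψ Λ => trIP_lapSL_GpY_adjoint i hG hU Ψ Λ) (by positivity) (fun Ψ hΨ => ?_) Λ hΛ
  -- `Ψ` supported in `B`, `A ∩ B = ∅` ⇒ `Ψ = 0` on `A`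
  have hΨA : ∀ z ∈ A, Ψ z = 0 := fun z hz => hΨ z (Finset.disjoint_left.1 hAB hz)
  exact hs_restrict_lapSL_GpY_le i hG hC0 hC1 hreg hω hb1 hb2 hs hκ hΨ hΨA hωB hĀ hj₁ hjA hjB hW0 hW

/-- ★★★ **THE `G′(U)Δ_U` ENTRY WITH THE CANONICAL AGMON WEIGHT** `e^{δ₀ρ}`, `δ₀ = 1∕(4(d+2))` (`ρ` bond-Lipschitz at scale `(L^{lev})⁻¹`, block oscillation `≤ d+1`,
`ρ = 0` on `B`, `ρ ≥ r` on `Ā`; `A` disjoint from `B`): `Σ_{z∈B} HS((G′(U)Δ_Uλ)(z)) ≤ 256·((L^{j₁})⁻⁴(L^{j_Ā})²(L^{j_B})²∕(e^{δ₀r})²)·‖λ‖²₁` for `λ` vanishing off `A`.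
[cite: Balaban1985BackgroundPropagators, Thm 3.1 (3.46) p.398; Agmon1982, Ch.1, Thm 1.5] -/
theorem hs_restrict_GpY_lapSL_le_exp_canonical [Nonempty (Fin N)] (hG : G ≤ B7Prop2Explicit.unitaryUnits (Matrix (Fin N) (Fin N) ℂ))
    {U : CfgY (Matrix (Fin N) (Fin N) ℂ) i} {c α₀ : ℝ} (hC0 : 0 ≤ c * (kGeo i).M * α₀) (hC1 : c * (kGeo i).M * α₀ * ((d : ℝ) + 1) ≤ 1 / 16)
    (hreg : (bg9K (Matrix (Fin N) (Fin N) ℂ) G i).Reg335 c α₀ U) {ρ : SiteY i → ℝ}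
    (hρ1 : ∀ μ z, |ρ (shiftY i μ z) - ρ z| ≤ ((((ℓ + 1) ^ (blkOf i.D.toDomains z).1.1 : ℕ) : ℝ))⁻¹)
    (hρ2 : ∀ μ z, |ρ (shiftY i μ z) - ρ z| ≤ ((((ℓ + 1) ^ (blkOf i.D.toDomains (shiftY i μ z)).1.1 : ℕ) : ℝ))⁻¹)
    (hρD : ∀ z w : SiteY i, blkOf i.D.toDomains w = blkOf i.D.toDomains z → |ρ z - ρ w| ≤ (d : ℝ) + 1)
    {A Abar B : Finset (SiteY i)} (hAB : Disjoint A B) (hρB : ∀ z ∈ B, ρ z = 0)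
    (hĀ : ∀ z ∈ A, ∀ w, blkOf i.D.toDomains w = blkOf i.D.toDomains z → w ∈ Abar) {j₁ jA jB : ℕ} (hj₁ : ∀ z ∈ A, j₁ ≤ (blkOf i.D.toDomains z).1.1)
    (hjA : ∀ z ∈ Abar, (blkOf i.D.toDomains z).1.1 ≤ jA) (hjB : ∀ z ∈ B, (blkOf i.D.toDomains z).1.1 ≤ jB) {r : ℝ} (hr : ∀ z ∈ Abar, r ≤ ρ z)
    (Λ : SiteY i → Matrix (Fin N) (Fin N) ℂ) (hΛ : ∀ z, z ∉ A → Λ z = 0) :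
    ∑ z ∈ B, ∑ a, ∑ b, ‖GpY i (parSymY i) U (lapSL i U Λ) z a b‖ ^ 2
      ≤ 256 * (((((((ℓ + 1) ^ j₁ : ℕ) : ℝ)) ^ 2)⁻¹) ^ 2 *
          (((((ℓ + 1) ^ jA : ℕ) : ℝ)) ^ 2 * ((((ℓ + 1) ^ jB : ℕ) : ℝ)) ^ 2 / Real.exp ((1 / (4 * ((d : ℝ) + 2))) * r) ^ 2)) * trIP (fun _ => (1 : ℝ)) Λ Λ := by
  have hd0 : (0 : ℝ) ≤ d := Nat.cast_nonneg d
  have hd2 : (0 : ℝ) < 4 * ((d : ℝ) + 2) := by positivity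
  have hδ0 : (0 : ℝ) ≤ 1 / (4 * ((d : ℝ) + 2)) := by positivity
  have hδ1 : 1 / (4 * ((d : ℝ) + 2)) ≤ 1 := by rw [div_le_one hd2]; linarith
  have hδD : 1 / (4 * ((d : ℝ) + 2)) * ((d : ℝ) + 1) ≤ 1 := by
    rw [div_mul_eq_mul_div, one_mul, div_le_one hd2]; linarith
  have hδκ0 : (1 / (4 * ((d : ℝ) + 2))) ^ 2 * (2 * ((d : ℝ) + 1) + ((d : ℝ) + 1) ^ 2) ≤ 1 / 16 := by
    rw [div_pow, one_pow, mul_pow, one_div_mul_eq_div, div_le_iff₀ (by positivity)]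
    nlinarith
  have hδκ : ((d : ℝ) + 1) * (2 * (1 / (4 * ((d : ℝ) + 2))) ^ 2) + (2 * (1 / (4 * ((d : ℝ) + 2))) ^ 2 * ((d : ℝ) + 1) ^ 2) / 2 ≤ 1 / 16 := by
    have e : ((d : ℝ) + 1) * (2 * (1 / (4 * ((d : ℝ) + 2))) ^ 2) + (2 * (1 / (4 * ((d : ℝ) + 2))) ^ 2 * ((d : ℝ) + 1) ^ 2) / 2
        = (1 / (4 * ((d : ℝ) + 2))) ^ 2 * (2 * ((d : ℝ) + 1) + ((d : ℝ) + 1) ^ 2) := by ring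
    rw [e]; exact hδκ0
  have hω : ∀ z, 0 < Real.exp (1 / (4 * ((d : ℝ) + 2)) * ρ z) := fun z => Real.exp_pos _
  have hωB : ∀ z ∈ B, Real.exp (1 / (4 * ((d : ℝ) + 2)) * ρ z) = 1 := fun z hz => by rw [hρB z hz, mul_zero, Real.exp_zero]
  have hW : ∀ z ∈ Abar, Real.exp (1 / (4 * ((d : ℝ) + 2)) * r) ≤ Real.exp (1 / (4 * ((d : ℝ) + 2)) * ρ z) :=
    fun z hz => Real.exp_le_exp.2 (mul_le_mul_of_nonneg_left (hr z hz) hδ0)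
  exact hs_restrict_GpY_lapSL_le i hG hC0 hC1 hreg hω (fun μ z => bondRatio_exp_le i hδ0 hδ1 μ z (hρ1 μ z))
    (fun μ z => bondRatio_exp_le' i hδ0 hδ1 μ z (hρ2 μ z)) (fun z w hzw => blockOsc_exp_le i hδ0 hδD z w (hρD z w hzw)) hδκ hAB hωB hĀ hj₁ hjA hjB
    (Real.exp_pos _) hW Λ hΛ

end Literature.MathematicalPhysics.QuantumFieldTheory.Balaban1983to89.B9Thm31SiteGpLapDecayReg335Y
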